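import Literature.MathematicalPhysics.QuantumFieldTheory.CFTAxioms
import HarnessLib

/-!
# The mean-field counterexample to the v0 bootstrap-island template

`Literature.MathematicalPhysics.QuantumFieldTheory.BootstrapIsland` (file `CFTAxioms.lean`) asserts
the Kos–Poland–Simmons-Duffin–Vichi island `Δ_σ ∈ [0.5181479, 0.5181499]`,
`Δ_ε ∈ [1.412615, 1.412635]` for *every* `IsIsingLikeCFT B D` with `B.IsStandard`. Its own design
notes call it "presumably false for the v0 hypothesis", because `ConformalBlocks.IsStandard`
(normalisation `g_{0,0} = 1` + continuity on the convergence square) lets one *tailor* the blocks.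
This file makes that precise, relative to the existence of the mean-field correlators (a
hypothesis predicate, not a new named fact — D-0026):

* `IsMeanFieldFamily Δ S` (definition): `S` is a family of Euclidean `n`-point functions that is
  Möbius covariant with dimension `Δ`, Osterwalder–Schrader reflection positive
  (`IsOSPositiveFamily`, the pointwise form used by `CFTData.IsOSPositive`), normalised
  `S₂(x,y) = ‖x - y‖^{-2Δ}`, with vanishing odd correlators and the Wick four-point function
  `S₄ = (x₁₂x₃₄)^{-2Δ} (1 + u^Δ + (u/v)^Δ)`. The *mean field theory* (generalised free field)
  of dimension `Δ` — the hafnian family of `‖x - y‖^{-2Δ}` — is such a family for every `Δ` at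
  or above the unitarity bound `(d-2)/2` (Poland–Rychkov–Vichi, Rev. Mod. Phys. 91 (2019)
  015002, §III.I.1: "such a MFT is unitary as long as `Δ_φ` satisfies the unitarity bound"; the
  block decomposition of `1 + u^Δ + (u/v)^Δ` is the "gaussian line `Δ_ε = 2Δ_σ`" of El-Showk
  et al. 2012, §5.2). That existence statement is classical but is NOT formalised here (it needs
  reflection positivity of `‖θx - y‖^{-2Δ}` on the half-space and the Fock/permanent structure
  of Wick families); it enters only as the hypothesis `IsMeanFieldFamily 1 S`.
* `mfBlocks`, `mfData S`: tailored blocks `g_{0,0} = 1`, `g_{Δ,ℓ}(u,v) = u + u/v` otherwise, and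
  CFT data on four labels `𝟙, σ, ε, T` with `Δ = (0, 1, 1, 3)`, spins `(0, 0, 0, 2)`,
  `ℤ₂ = (+, -, +, +)`, OPE coefficients `λ_{𝟙𝟙𝟙} = λ_{σσ𝟙} = λ_{σσε} = λ_{εε𝟙} = λ_{εεT} = 1`
  (all others `0`), correlators `⟨𝟙⋯𝟙⟩ ≡ 1`, `⟨σ⋯σ⟩ = ⟨ε⋯ε⟩ = S` (the mean-field family of
  dimension `1`), `⟨T⋯T⟩ ≡ 0` (spin `2`: no axiom of `IsUnitaryCFTData` constrains it).
* `isIsingLikeCFT_mfData`: these data satisfy `IsIsingLikeCFT mfBlocks (mfData S)` — unitary,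
  `ℤ₂`-symmetric, `σ`/`ε` the unique relevant odd/even non-unit scalars, convergent (finite!)
  crossing-symmetric OPEs `g_σ(u,v) = g_ε(u,v) = 1 + u + u/v`.
* `not_bootstrapIsland_of_isMeanFieldFamily : IsMeanFieldFamily 1 S → ¬ BootstrapIsland` (and
  the `∃`-form `not_bootstrapIsland_of_exists_isMeanFieldFamily`), since
  `Δ_σ = 1 ∉ [0.5181479, 0.5181499]`.

Remarks recorded for the planner (details: the literature-prover's ESTIMATE.md for this fact).
(1) Genuine Dolan–Osborn blocks would not rescue `BootstrapIsland`: mean field theory with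
`Δ_φ ∈ [1, 3/2)` (`σ = φ`, `ε = φ²`, `Δ_ε = 2Δ_φ`, next scalars `φ³` at `3Δ_φ ≥ 3`, `φ⁴`,
`[φφ]_{1,0}` at `≥ 4`) is a unitary crossing solution with exactly one relevant odd and one relevant
non-unit even scalar; it lies in the "bulk region `Δ_σ ≳ 0.54`" that the mixed-correlator bootstrap
leaves ALLOWED (Kos–Poland–Simmons-Duffin 2014, §5.3; Poland–Rychkov–Vichi 2019, §V.B.1) — the
printed island is the connected component around Ising and needs a localisation hypothesis.
(2) `IsIsingLikeCFT` carries single-correlator crossing only; the island requires `⟨σσεε⟩`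
(Kos–Poland–Simmons-Duffin 2014, §5.2–5.3). (3) The printed numbers are a floating-point SDPB grid
scan at `Λ = 43` (Kos–Poland–Simmons-Duffin–Vichi 2016, §3 and App. A), not a certificate.

Mathlib/tree search: no mean-field / generalised-free-field family, hafnian or Wick family in
Mathlib or `Literature` (`lean search 'MeanField|GeneralizedFree|hafnian|Wick'`); the OS predicates
of `Literature.MathematicalPhysics.QuantumLattice.SchwingerOSAxioms` are distribution-level and do
not apply to the pointwise `CorrFamily` of `CFTData`, whence `IsOSPositiveFamily` below.

Design choices. No named fact is minted: the mean-field input is the hypothesis predicate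
`IsMeanFieldFamily` (stated for any `d`, used at `d = 3`, `Δ = 1`). `mfData` is an `abbrev` so that
`(mfData S).ι = Fin 4` is seen by instance search. What is NOT here: the construction of the
mean-field family itself, and no corrected island statement (it needs characterised blocks, mixed
correlators and a localisation window, none in the v0 prelude).
-/

noncomputable section

namespace Literature.MathematicalPhysics.QuantumFieldTheory

open Literature.Probability.LatticeModels

variable {d : ℕ}

/-! ### Pointwise OS positivity of one correlation family -/

/-- Osterwalder–Schrader reflection positivity of a single family of Euclidean `n`-point functions,
pointwise form: for all finitely many configurations `xₐ ∈ (ℝ^d_{>0})^{nₐ}` in the open half-space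
and real coefficients `cₐ`, `∑_{a,b} cₐ c_b S_{nₐ+n_b}(θxₐ, x_b) ≥ 0` (`θ = timeReflection`).
This is verbatim the clause of `CFTData.IsOSPositive` for one scalar (`isOSPositive_iff`).
(Osterwalder–Schrader 1973, axiom (E2); Kravchuk–Qiao–Rychkov 2021, §2.1.) [cite: KravchukQiaoRychkov2021, §2.1] -/
def IsOSPositiveFamily (S : CorrFamily d) : Prop :=
  ∀ (k : ℕ) (n : Fin k → ℕ) (x : (a : Fin k) → Fin (n a) → EuclideanSpace ℝ (Fin d))
    (c : Fin k → ℝ), (∀ a j, x a j ∈ positiveHalfSpace d) →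
      0 ≤ ∑ a, ∑ b, c a * c b *
        S (n a + n b) (Fin.append (fun j => timeReflection (x a j)) (x b))

/-- `CFTData.IsOSPositive` is `IsOSPositiveFamily` of every scalar family (definitional).
(Kravchuk–Qiao–Rychkov 2021, §2.1.) [cite: KravchukQiaoRychkov2021, §2.1] -/
theorem isOSPositive_iff (D : CFTData d) :
    D.IsOSPositive ↔ ∀ i, D.spin i = 0 → IsOSPositiveFamily (D.corr i) :=
  Iff.rfl

/-- The constant family `S_n ≡ 1` (the correlators of the identity operator) is OS positive:
`∑_{a,b} cₐ c_b = (∑ₐ cₐ)² ≥ 0`. Elementary. [folklore] -/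
theorem isOSPositiveFamily_const_one (d : ℕ) :
    IsOSPositiveFamily (d := d) (fun _ _ => (1 : ℝ)) := by
  intro _ _ _ c _
  have h : ∑ a, ∑ b, c a * c b * (1 : ℝ) = (∑ a, c a) * (∑ b, c b) := by
    rw [Finset.sum_mul_sum]
    simp
  rw [h]
  exact mul_self_nonneg _

/-- The constant family `S_n ≡ 1` is Möbius covariant with scaling dimension `0` (all conformal
factors are `1`). Elementary. (Di Francesco–Mathieu–Sénéchal 1997, §4.3.1, eq. (4.62) with
`Δ = 0`.) [cite: FrancescoMathieuSenechal1997, §4.3.1 eq. (4.62)] -/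
theorem isMoebiusCovariant_const_one (d : ℕ) :
    IsMoebiusCovariant (d := d) 0 (fun _ _ => (1 : ℝ)) := by
  refine ⟨⟨fun _ _ _ => rfl, fun _ _ _ => rfl⟩, fun _ _ _ _ => ?_, fun _ _ _ => ?_⟩
  · simp
  · simp

/-! ### Mean-field (generalised free) correlation families -/

/-- `S` is a **mean-field (generalised free) family of dimension `Δ`** on `ℝ^d`: Möbius covariant
with dimension `Δ`, Osterwalder–Schrader reflection positive, two-point normalised
`S₂(x,y) = ‖x - y‖^{-2Δ}` (`x ≠ y`), with vanishing odd correlators, and with the Wick four-point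
function at non-coincident points,
`S₄(x) = (‖x₀-x₁‖ ‖x₂-x₃‖)^{-2Δ} (1 + u^Δ + (u/v)^Δ)` (`u, v` the cross-ratios `crossRatioU`,
`crossRatioV`; this is `S₂S₂ + S₂S₂ + S₂S₂` factorised). These are exactly the properties of the
correlators `⟨φ(x₁)⋯φ(xₙ)⟩` of the mean-field scalar `φ` of dimension `Δ` (generated by Wick's
theorem from `⟨φ(x)φ(y)⟩ = ‖x - y‖^{-2Δ}`), which is unitary for `Δ` at or above the unitarity
bound `(d-2)/2` (Poland–Rychkov–Vichi, Rev. Mod. Phys. 91 (2019) 015002, §III.I.1; El-Showk et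
al., Phys. Rev. D 86 (2012) 025022, §5.2, the gaussian line). The existence of such a family is
not formalised here; the predicate is the hypothesis of the refutation below. [cite: PolandRychkovVichi2019, §III.I.1] -/
def IsMeanFieldFamily (Δ : ℝ) (S : CorrFamily d) : Prop :=
  IsMoebiusCovariant Δ S ∧ IsOSPositiveFamily S ∧
    (∀ x y : EuclideanSpace ℝ (Fin d), x ≠ y → S 2 ![x, y] = ‖x - y‖ ^ (-2 * Δ)) ∧
    (∀ n : ℕ, Odd n → ∀ x : Fin n → EuclideanSpace ℝ (Fin d), S n x = 0) ∧
    ∀ x : Fin 4 → EuclideanSpace ℝ (Fin d), x ∈ NonCoincident d 4 →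
      S 4 x = (‖x 0 - x 1‖ * ‖x 2 - x 3‖) ^ (-2 * Δ) *
        (1 + crossRatioU x ^ Δ + (crossRatioU x / crossRatioV x) ^ Δ)

/-- A mean-field family is Möbius covariant with its dimension. (Poland–Rychkov–Vichi 2019,
§III.I.1.) [cite: PolandRychkovVichi2019, §III.I.1] -/
theorem IsMeanFieldFamily.isMoebiusCovariant {Δ : ℝ} {S : CorrFamily d}
    (h : IsMeanFieldFamily Δ S) : IsMoebiusCovariant Δ S :=
  h.1

/-- A mean-field family is OS reflection positive. (Poland–Rychkov–Vichi 2019, §III.I.1,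
"such a MFT is unitary as long as `Δ_φ` satisfies the unitarity bound".) [cite: PolandRychkovVichi2019, §III.I.1] -/
theorem IsMeanFieldFamily.isOSPositiveFamily {Δ : ℝ} {S : CorrFamily d}
    (h : IsMeanFieldFamily Δ S) : IsOSPositiveFamily S :=
  h.2.1

/-! ### Tailored blocks and the four-label CFT data -/

/-- Tailored "conformal blocks" admitted by the v0 predicate `ConformalBlocks.IsStandard`:
`g_{0,0} ≡ 1` and `g_{Δ,ℓ}(u,v) = u + u/v` for `Δ ≠ 0` — the whole non-identity part of the
mean-field four-point function of dimension `1` packed into a single block. (Counterexample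
construction; cf. the design notes of `CFTAxioms.lean` on `BootstrapIsland`.) [folklore] -/
def mfBlocks : ConformalBlocks 3 :=
  ⟨fun Δ _ u v => if Δ = 0 then 1 else u + u / v⟩

/-- The tailored blocks satisfy the v0 hypothesis `IsStandard` (normalisation and continuity on the
convergence square, where `v ≠ 0`). [folklore] -/
theorem mfBlocks_isStandard : mfBlocks.IsStandard := by
  refine ⟨fun u v => by simp [mfBlocks], fun Δ _ => ?_⟩
  by_cases hΔ : Δ = 0
  · simp only [mfBlocks, hΔ, if_true]
    exact continuousOn_const
  · simp only [mfBlocks, hΔ, if_false]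
    refine continuousOn_fst.add (continuousOn_fst.div continuousOn_snd fun p hp => ?_)
    exact ((mem_crossRatioSquare p.1 p.2).1 hp).2.1.ne'

/-- OPE weights `w i k = λ_{i i k}` of the four-label data (`0 = 𝟙`, `1 = σ`, `2 = ε`, `3 = T`):
`λ_{𝟙𝟙𝟙} = λ_{σσ𝟙} = λ_{σσε} = λ_{εε𝟙} = λ_{εεT} = 1`, all other diagonal coefficients `0`.
[folklore] -/
def mfWeight : Fin 4 → Fin 4 → ℝ :=
  ![![1, 0, 0, 0], ![1, 0, 1, 0], ![1, 0, 0, 1], ![0, 0, 0, 0]]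

/-- The four-label CFT data of the counterexample: labels `0 = 𝟙`, `1 = σ`, `2 = ε`, `3 = T`,
dimensions `(0, 1, 1, 3)`, spins `(0, 0, 0, 2)`, `ℤ₂`-charges `(+, -, +, +)`, OPE coefficients
`λ_{ijk} = [i = j] · mfWeight i k`, correlators `⟨𝟙⋯𝟙⟩ ≡ 1`, `⟨σ⋯σ⟩ = ⟨ε⋯ε⟩ = S`,
`⟨T⋯T⟩ ≡ 0`. An `abbrev`, so that `(mfData S).ι` reduces to `Fin 4`. [folklore] -/
abbrev mfData (S : CorrFamily 3) : CFTData 3 where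
  ι := Fin 4
  Δ := ![0, 1, 1, 3]
  spin := ![0, 0, 0, 2]
  z2Odd := ![false, true, false, false]
  unit := 0
  ope := fun i j k => if i = j then mfWeight i k else 0
  corr := ![fun _ _ => 1, S, S, fun _ _ => 0]

/-- The OPE sum of the four-label data is a finite sum over the four labels. [folklore] -/
theorem fourPointFromOPE_mfData (S : CorrFamily 3) (i : Fin 4) (u v : ℝ) :
    fourPointFromOPE mfBlocks (mfData S) i u v =
      ∑ O : Fin 4,
        (mfData S).ope i i O ^ 2 * mfBlocks.g ((mfData S).Δ O) ((mfData S).spin O) u v := by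
  rw [fourPointFromOPE_eq_tsum]
  exact tsum_fintype _

/-- The stripped four-point function of `𝟙` reconstructed from the OPE is `1`. [folklore] -/
theorem fourPointFromOPE_mfData_unit (S : CorrFamily 3) (u v : ℝ) :
    fourPointFromOPE mfBlocks (mfData S) (0 : Fin 4) u v = 1 := by
  rw [fourPointFromOPE_mfData, Fin.sum_univ_four]
  simp [mfWeight, mfBlocks]

/-- The stripped four-point function of `σ` reconstructed from the OPE is the mean-field one,
`1 + u + u/v`. [folklore] -/
theorem fourPointFromOPE_mfData_sigma (S : CorrFamily 3) (u v : ℝ) :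
    fourPointFromOPE mfBlocks (mfData S) (1 : Fin 4) u v = 1 + u + u / v := by
  rw [fourPointFromOPE_mfData, Fin.sum_univ_four]
  simp [mfWeight, mfBlocks]
  ring

/-- The stripped four-point function of `ε` reconstructed from the OPE is the mean-field one,
`1 + u + u/v`. [folklore] -/
theorem fourPointFromOPE_mfData_epsilon (S : CorrFamily 3) (u v : ℝ) :
    fourPointFromOPE mfBlocks (mfData S) (2 : Fin 4) u v = 1 + u + u / v := by
  rw [fourPointFromOPE_mfData, Fin.sum_univ_four]
  simp [mfWeight, mfBlocks]
  ring

/-- Crossing symmetry of the mean-field stripped four-point function of dimension `1`: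
`v (1 + u + u/v) = u (1 + v + v/u)` for `u, v ≠ 0`. Elementary algebra.
(El-Showk et al. 2012, §5.2, the gaussian solution.) [cite: ElShowkEtAl2012, §5.2] -/
theorem mf_crossing {u v : ℝ} (hu : u ≠ 0) (hv : v ≠ 0) :
    v ^ (1 : ℝ) * (1 + u + u / v) = u ^ (1 : ℝ) * (1 + v + v / u) := by
  rw [Real.rpow_one, Real.rpow_one]
  field_simp
  ring

/-! ### The counterexample is an Ising-like CFT in the sense of `IsIsingLikeCFT` -/

/-- **The mean-field data are Ising-like for the tailored blocks.** If `S` is a mean-field family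
of dimension `1` (`IsMeanFieldFamily 1 S`: Möbius covariant, OS positive, two-point normalised,
odd correlators zero, four-point function `(x₁₂x₃₄)⁻²(1 + u + u/v)`), then `mfData S` with the
blocks `mfBlocks` satisfies every clause of `IsIsingLikeCFT`: unitary CFT data, `ℤ₂` symmetry, `σ`
(label `1`, `Δ = 1`) the unique relevant odd scalar, `ε` (label `2`, `Δ = 1`) the unique relevant
non-unit even scalar, and finite, crossing-symmetric OPEs for the scalars `𝟙, σ, ε`.
(Counterexample mechanism anticipated in the design notes of `CFTAxioms.lean`.) [folklore] -/
theorem isIsingLikeCFT_mfData {S : CorrFamily 3} (hS : IsMeanFieldFamily 1 S) :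
    IsIsingLikeCFT mfBlocks (mfData S) := by
  obtain ⟨hcov, hOS, h2, hodd, h4⟩ := hS
  refine ⟨⟨?_, ?_, ?_, ?_, ?_⟩, ⟨?_, ?_⟩, ?_, ?_, ?_⟩
  · -- well-formed spectrum
    refine ⟨rfl, rfl, rfl, fun i hi => ?_⟩
    fin_cases i
    · exact absurd rfl hi
    · show (0 : ℝ) < 1
      norm_num
    · show (0 : ℝ) < 1
      norm_num
    · show (0 : ℝ) < 3
      norm_num
  · -- Möbius covariance of the scalar families
    intro i hi
    fin_cases i
    · exact isMoebiusCovariant_const_one 3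
    · exact hcov
    · exact hcov
    · change (2 : ℕ) = 0 at hi
      exact absurd hi (by norm_num)
  · -- unitarity bounds
    intro i hi
    fin_cases i
    · exact absurd rfl hi
    · refine ⟨fun _ => ?_, fun h => ?_⟩
      · show ((3 : ℕ) - 2 : ℝ) / 2 ≤ 1
        norm_num
      · change 1 ≤ (0 : ℕ) at h
        exact absurd h (by norm_num)
    · refine ⟨fun _ => ?_, fun h => ?_⟩
      · show ((3 : ℕ) - 2 : ℝ) / 2 ≤ 1
        norm_num
      · change 1 ≤ (0 : ℕ) at h
        exact absurd h (by norm_num)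
    · refine ⟨fun h => ?_, fun _ => ?_⟩
      · change (2 : ℕ) = 0 at h
        exact absurd h (by norm_num)
      · show ((2 : ℕ) : ℝ) + (3 : ℕ) - 2 ≤ 3
        norm_num
  · -- OS reflection positivity
    intro i hi
    fin_cases i
    · exact isOSPositiveFamily_const_one 3
    · exact hOS
    · exact hOS
    · change (2 : ℕ) = 0 at hi
      exact absurd hi (by norm_num)
  · -- two-point normalisation
    intro i hi x y hxy
    fin_cases i
    · show (1 : ℝ) = ‖x - y‖ ^ (-2 * (0 : ℝ))
      simp
    · exact h2 x y hxy
    · exact h2 x y hxy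
    · change (2 : ℕ) = 0 at hi
      exact absurd hi (by norm_num)
  · -- odd correlators of odd operators vanish
    intro i hi n hn x
    fin_cases i
    · change false = true at hi
      exact absurd hi (by decide)
    · exact hodd n hn x
    · change false = true at hi
      exact absurd hi (by decide)
    · change false = true at hi
      exact absurd hi (by decide)
  · -- ℤ₂ selection rule for the OPE coefficients
    intro i j k h
    by_cases hij : i = j
    · subst hij
      fin_cases i <;> fin_cases k <;> simp [mfWeight] at h ⊢
    · simp [hij]
  · -- σ is the unique relevant ℤ₂-odd scalar
    refine ⟨(1 : Fin 4), ⟨rfl, rfl, ?_⟩, fun s hs => ?_⟩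
    · show (1 : ℝ) < (3 : ℕ)
      norm_num
    · obtain ⟨hspin, hodd', _⟩ := hs
      fin_cases s
      · change false = true at hodd'
        exact absurd hodd' (by decide)
      · rfl
      · change false = true at hodd'
        exact absurd hodd' (by decide)
      · change (2 : ℕ) = 0 at hspin
        exact absurd hspin (by norm_num)
  · -- ε is the unique relevant non-unit ℤ₂-even scalar
    refine ⟨(2 : Fin 4), ⟨fun h => ?_, rfl, rfl, ?_⟩, fun e he => ?_⟩
    · change (2 : Fin 4) = 0 at h
      exact absurd h (by decide)
    · show (1 : ℝ) < (3 : ℕ)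
      norm_num
    · obtain ⟨hne, hspin, hodd', _⟩ := he
      fin_cases e
      · exact absurd rfl hne
      · change true = false at hodd'
        exact absurd hodd' (by decide)
      · rfl
      · change (2 : ℕ) = 0 at hspin
        exact absurd hspin (by norm_num)
  · -- convergent, crossing-symmetric OPEs of the scalars 𝟙, σ, ε
    intro i hi
    fin_cases i
    · show HasConvergentOPE mfBlocks (mfData S) (0 : Fin 4) ∧
        SatisfiesCrossing mfBlocks (mfData S) (0 : Fin 4)
      refine ⟨⟨by simp [mfWeight], fun p _ => (hasSum_fintype _).summable, fun x _ => ?_⟩,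
        fun u v _ => ?_⟩
      · rw [fourPointFromOPE_mfData_unit]
        show (1 : ℝ) = (‖x 0 - x 1‖ * ‖x 2 - x 3‖) ^ (-2 * (0 : ℝ)) * 1
        simp
      · rw [fourPointFromOPE_mfData_unit, fourPointFromOPE_mfData_unit]
        show v ^ (0 : ℝ) * 1 = u ^ (0 : ℝ) * 1
        simp
    · show HasConvergentOPE mfBlocks (mfData S) (1 : Fin 4) ∧
        SatisfiesCrossing mfBlocks (mfData S) (1 : Fin 4)
      refine ⟨⟨by simp [mfWeight], fun p _ => (hasSum_fintype _).summable, fun x hx => ?_⟩,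
        fun u v huv => ?_⟩
      · rw [fourPointFromOPE_mfData_sigma]
        have hx4 := h4 x (nonCoincident_of_mem_crossRatioSquare hx)
        rw [Real.rpow_one, Real.rpow_one] at hx4
        exact hx4
      · rw [fourPointFromOPE_mfData_sigma, fourPointFromOPE_mfData_sigma]
        rw [mem_crossRatioSquare] at huv
        exact mf_crossing huv.1.1.ne' huv.2.1.ne'
    · show HasConvergentOPE mfBlocks (mfData S) (2 : Fin 4) ∧
        SatisfiesCrossing mfBlocks (mfData S) (2 : Fin 4)
      refine ⟨⟨by simp [mfWeight], fun p _ => (hasSum_fintype _).summable, fun x hx => ?_⟩,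
        fun u v huv => ?_⟩
      · rw [fourPointFromOPE_mfData_epsilon]
        have hx4 := h4 x (nonCoincident_of_mem_crossRatioSquare hx)
        rw [Real.rpow_one, Real.rpow_one] at hx4
        exact hx4
      · rw [fourPointFromOPE_mfData_epsilon, fourPointFromOPE_mfData_epsilon]
        rw [mem_crossRatioSquare] at huv
        exact mf_crossing huv.1.1.ne' huv.2.1.ne'
    · change (2 : ℕ) = 0 at hi
      exact absurd hi (by norm_num)

/-! ### The refutation of the v0 island template -/

/-- **`BootstrapIsland` is false for the v0 block hypothesis, given the mean-field family.**
If `S` is a mean-field family of dimension `Δ = 1 (≥ 1/2)` on `ℝ³`, the data `mfData S` with the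
tailored standard blocks `mfBlocks` form an `IsIsingLikeCFT` with
`Δ_σ = 1 ∉ [0.5181479, 0.5181499]`, contradicting `BootstrapIsland`. (Mechanism: Poland–Rychkov–Vichi 2019, §III.I.1 (mean field
theories "frequently fall inside regions allowed by the bootstrap bounds") and §V.B.1 (the allowed
"bulk" region beside the Ising island); Kos–Poland–Simmons-Duffin 2014, §5.3.) [cite: PolandRychkovVichi2019, §III.I.1 and §V.B.1] -/
theorem not_bootstrapIsland_of_isMeanFieldFamily {S : CorrFamily 3} (hS : IsMeanFieldFamily 1 S) :
    ¬ BootstrapIsland := by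
  intro hI
  have hIL : IsIsingLikeCFT mfBlocks (mfData S) := isIsingLikeCFT_mfData hS
  have hσ : (1 : Fin 4) = hIL.sigmaField :=
    hIL.eq_sigmaField (s := (1 : Fin 4)) rfl rfl (show (1 : ℝ) < (3 : ℕ) by norm_num)
  have hΔ : hIL.deltaSigma = 1 := by
    show (mfData S).Δ hIL.sigmaField = 1
    rw [← hσ]
    rfl
  have hmem := (hI mfBlocks (mfData S) hIL mfBlocks_isStandard).1
  rw [hΔ, Set.mem_Icc] at hmem
  norm_num at hmem

/-- `∃`-form: if a three-dimensional mean-field family of dimension `1` exists (mean field theory,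
Poland–Rychkov–Vichi 2019, §III.I.1), then the v0 island template `BootstrapIsland` fails.
(Kos–Poland–Simmons-Duffin 2014, §5.3: the bootstrap-allowed "big region at `Δ_σ ≳ 0.54`".) [cite: KosPolandSimmonsduffin2014, §5.3] -/
theorem not_bootstrapIsland_of_exists_isMeanFieldFamily
    (h : ∃ S : CorrFamily 3, IsMeanFieldFamily 1 S) : ¬ BootstrapIsland :=
  fun hI => h.elim fun _ hS => not_bootstrapIsland_of_isMeanFieldFamily hS hI

end Literature.MathematicalPhysics.QuantumFieldTheory

end
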